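/-
COR-CM (cell pub-hodgecm2, stage 2 of the Hodge ladder) — count-neutral KERNEL COMBINATORICS «the binary tetrahedral group SL(2,3)», part IX: the BLOCKS of the
model and the RESIDUAL COUNT (seat prover-pub-hodgecm2-b23-g53-0, binder prover b23, gen 53; claim HOME/INBOX.md l.24246, NAME ASK l.24300).  Bookkeeping
definitions with bodies (`blockSetoid`, `Block`, `blk`, `potB` — the motion relation `Step` is a local notation, not a definition —, the odd position `pos`, the untwisting `rot`/`rotP`, the untwisted signature `code`, `term`,
`sig₃`, `inv₃`) + theorems — gen 45ʼs `Census/OcticProductBlocks.lean` + `…ResidualBlocks.lean` for the motions of part IV with `A = ℤ/3`, shear `1`;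
`decide` only on closed Boolean/`Fin 4`/`ℤ/3` identities over literal patterns (invariance of the untwisted signature), no certificate, no named fact, no
`sorry`.  `Interfaces.lean` (C1), every E term, B01, `Transposition/*`, `PortJoin/*`, `D2Bridge/*` untouched.
HONEST FRAMING: `HC_CM` is NOT proved, here or anywhere in the tree; nothing here is a period, a count of record or a headline.
T5: n/a-class (no hypothesis binders); checker: self.
-/
import Summits.HodgeConjecture.CorCM.Census.QuarticInversionResidualBlocks
import Summits.HodgeConjecture.CorCM.Census.OcticProductBlocks
import Summits.HodgeConjecture.CorCM.Census.BinaryTetrahedralModel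

/-!
# The binary tetrahedral group, IX: the blocks of the model, an invariant, and the ten residual blocks

THE MODEL of `SL(2,3)` is part IVʼs with `A = ℤ/3`, shear `σ = 1` (motions `twH₄ (ζ, 0)`, `twZ 1`, `twT`, `twA 1`).
* §1 **Blocks**: reachability by chains of motions (every motion is undone by a chain: `c² = 1`, `i⁴ = 1`, `k⁴ = 1`, `a³ = 1`); the potential `potB` of a
  block.
* §2 **An invariant separating the residual blocks.**  The atom position `pos ψ ∈ ℤ/3` of a coordinate, the untwisting `rot s`/`rotP s` (apply the
  coordinate rotation `s` times), and the **untwisted signature** `code m s h` = gen 44ʼs Boolean signature (`sigAll 1`, its three class-weighted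
  components) of the atom coordinate `m` and the halves `h` read after untwisting by `aˢ`; `code` is invariant under the actions of `i`, `k`, `c`, `a`
  on triples `(m, s, h)` (four `decide`s), hence the class-weighted fold `sig₃ Θ` and `inv₃ Θ = (pot₄ Θ, parity of the halves, sig₃ Θ)` are block
  invariants (`inv₃_eq_of_blk_eq`).
* §3 **At least ten residual blocks** (`ten_le_card_residual`): the eight atom labels `aLab (F,x,y,z)` and two constant labels have pairwise distinct
  invariants (numerically: exactly ten — `work/numerics/sl23.py`, blocks `176 = 166 + 10`).
All [folklore] bookkeeping over [Pohlmann1968, Thm 1].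

## References
* [Pohlmann1968] H. Pohlmann, Algebraic cycles on abelian varieties of complex multiplication type, Ann. of Math. 88 (1968), Thm 1.
-/

namespace Summit.HodgeConjecture.CorCM.Census.BinaryTetrahedral

open Finset
open Summit.HodgeConjecture.CorCM.Census.OddSliceFacesModel
open Summit.HodgeConjecture.CorCM.Census.OddSliceFacesSquares (clsTy clsTy_tw)
open Summit.HodgeConjecture.CorCM.Census.QuarticInversion
open Summit.HodgeConjecture.CorCM.Census.OcticProduct (twZ twZ_twZ pot₄_twZ coord_twZ hv_twZ cl_twZ)

noncomputable section

/-! ## §1 The blocks of the model -/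

/-- One motion of the model of `SL(2,3)` (`c`, `i`, `k` or `a`), as a relation on labels (notation, not a definition). [folklore] -/
local notation "Step" => (fun Θ₁ Θ₂ : Ty₄ (ZMod 3) =>
  (∃ ζ : ZMod 2, Θ₂ = twH₄ (ZMod 3) (ζ, 0) Θ₁) ∨ Θ₂ = twZ (ZMod 3) 1 Θ₁ ∨ Θ₂ = twT (ZMod 3) Θ₁ ∨ Θ₂ = twA (ZMod 3) 1 Θ₁)

/-- Every motion is undone by a chain of motions. [folklore] -/
theorem step_rev {Θ Θ' : Ty₄ (ZMod 3)} (h : Step Θ Θ') : Relation.ReflTransGen Step Θ' Θ := by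
  rcases h with ⟨ζ, rfl⟩ | rfl | rfl | rfl
  · refine Relation.ReflTransGen.single (Or.inl ⟨ζ, ?_⟩)
    rw [twH₄_twH₄, Prod.mk_add_mk, add_zero, CharTwo.add_self_eq_zero, ← Prod.zero_eq_mk, twH₄_zero]
  · refine Relation.ReflTransGen.tail (Relation.ReflTransGen.single (Or.inr (Or.inl rfl))) (Or.inl ⟨1, ?_⟩)
    rw [twZ_twZ, twH₄_twH₄, Prod.mk_add_mk, add_zero, CharTwo.add_self_eq_zero, ← Prod.zero_eq_mk, twH₄_zero]
  · refine Relation.ReflTransGen.tail (Relation.ReflTransGen.single (Or.inr (Or.inr (Or.inl rfl)))) (Or.inl ⟨1, ?_⟩)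
    rw [twT_twT, twH₄_twH₄, Prod.mk_add_mk, add_zero, CharTwo.add_self_eq_zero, ← Prod.zero_eq_mk, twH₄_zero]
  · refine Relation.ReflTransGen.tail (Relation.ReflTransGen.single (Or.inr (Or.inr (Or.inr rfl)))) (Or.inr (Or.inr (Or.inr ?_)))
    rw [twA_twA_twA, show ((1 : ZMod 3) + 1 + 1) = 0 by decide, ← Prod.zero_eq_mk, twH₄_zero]

/-- **The block relation**: reachability by a chain of motions (an equivalence). [folklore] -/
def blockSetoid : Setoid (Ty₄ (ZMod 3)) where
  r := Relation.ReflTransGen Step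
  iseqv := by
    refine ⟨fun _ => Relation.ReflTransGen.refl, fun h => ?_, fun h₁ h₂ => h₁.trans h₂⟩
    induction h with
    | refl => exact Relation.ReflTransGen.refl
    | tail _ hs ih => exact (step_rev hs).trans ih

/-- **The blocks**: the orbits of `SL(2,3)` on the labels of the model. [folklore] -/
def Block : Type := Quotient blockSetoid

/-- The blocks form a finite type. [folklore] -/
noncomputable instance : Fintype Block := by
  classical exact Quotient.fintype blockSetoid

/-- Equality of blocks is decidable (classically). [folklore] -/
noncomputable instance : DecidableEq Block := Classical.decEq _

/-- The block of a label. [folklore] -/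
def blk (Θ : Ty₄ (ZMod 3)) : Block := Quotient.mk blockSetoid Θ

/-- Two labels have the same block iff a chain of motions joins them. [folklore] -/
theorem blk_eq_blk_iff (Θ Θ' : Ty₄ (ZMod 3)) : blk Θ = blk Θ' ↔ Relation.ReflTransGen Step Θ Θ' := Quotient.eq (r := blockSetoid)

/-- Every block has a label. [folklore] -/
theorem blk_surjective : Function.Surjective blk := Quotient.mk_surjective

/-- The central translations do not change the block. [folklore] -/
theorem blk_twH₄ (ζ : ZMod 2) (Θ : Ty₄ (ZMod 3)) : blk (twH₄ (ZMod 3) (ζ, 0) Θ) = blk Θ :=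
  ((blk_eq_blk_iff _ _).mpr (Relation.ReflTransGen.single (Or.inl ⟨ζ, rfl⟩))).symm

/-- `i` does not change the block. [folklore] -/
theorem blk_twZ (Θ : Ty₄ (ZMod 3)) : blk (twZ (ZMod 3) 1 Θ) = blk Θ :=
  ((blk_eq_blk_iff _ _).mpr (Relation.ReflTransGen.single (Or.inr (Or.inl rfl)))).symm

/-- `k` does not change the block. [folklore] -/
theorem blk_twT (Θ : Ty₄ (ZMod 3)) : blk (twT (ZMod 3) Θ) = blk Θ :=
  ((blk_eq_blk_iff _ _).mpr (Relation.ReflTransGen.single (Or.inr (Or.inr (Or.inl rfl))))).symm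

/-- `a` does not change the block. [folklore] -/
theorem blk_twA (Θ : Ty₄ (ZMod 3)) : blk (twA (ZMod 3) 1 Θ) = blk Θ :=
  ((blk_eq_blk_iff _ _).mpr (Relation.ReflTransGen.single (Or.inr (Or.inr (Or.inr rfl))))).symm

/-- **The potential is a block invariant.** [folklore] -/
theorem pot₄_eq_of_reach {Θ Θ' : Ty₄ (ZMod 3)} (h : Relation.ReflTransGen Step Θ Θ') : pot₄ (ZMod 3) Θ = pot₄ (ZMod 3) Θ' := by
  induction h with
  | refl => rfl
  | tail _ hs ih =>
    rw [ih]
    rcases hs with ⟨ζ, rfl⟩ | rfl | rfl | rfl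
    · exact (pot₄_twH₄ (ZMod 3) _ _).symm
    · exact (pot₄_twZ (ZMod 3) 1 _).symm
    · exact (pot₄_twT (ZMod 3) _).symm
    · exact (pot₄_twA (ZMod 3) 1 _).symm

/-- The potential of a block. [folklore] -/
def potB (B : Block) : ℕ := Quotient.liftOn B (pot₄ (ZMod 3)) fun _ _ h => pot₄_eq_of_reach h

/-- `potB (blk Θ) = pot₄ Θ`. [folklore] -/
@[simp] theorem potB_blk (Θ : Ty₄ (ZMod 3)) : potB (blk Θ) = pot₄ (ZMod 3) Θ := rfl

/-! ## §2 The untwisted signature: a block invariant -/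

/-- **The odd position** of a coordinate `ψ : ℤ/3 → ℤ/2`: where `ψ` differs from its other two values (`0` for constants). [folklore] -/
def pos (ψ : Ty (ZMod 3)) : ZMod 3 := if ψ 1 = ψ 2 then 0 else if ψ 0 = ψ 2 then 1 else 2

/-- `|ℤ/3|` is odd. [folklore] -/
private theorem odd3 : Odd (Fintype.card (ZMod 3)) := ⟨1, by simp⟩

/-- Coordinates are determined by their three values. [folklore] -/
theorem ty_eq_vec (ψ : Ty (ZMod 3)) : ψ = fun s : ZMod 3 => (![ψ 0, ψ 1, ψ 2] : Fin 3 → ZMod 2) s := by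
  funext s; fin_cases s <;> rfl

/-- Complementation keeps the odd position. [folklore] -/
theorem pos_add_one (ψ : Ty (ZMod 3)) : pos (ψ + 1) = pos ψ := by
  simp only [pos, Pi.add_apply, Pi.one_apply, add_left_inj]

/-- Adding a constant keeps the odd position. [folklore] -/
theorem pos_add_ite (ψ : Ty (ZMod 3)) (b : Bool) : pos (ψ + (if b then 1 else 0)) = pos ψ := by
  cases b
  · simp only [Bool.false_eq_true, ↓reduceIte, add_zero]
  · simp only [↓reduceIte, pos_add_one]

/-- A central translation keeps the odd position. [folklore] -/
theorem pos_tw_zero (ζ : ZMod 2) (ψ : Ty (ZMod 3)) : pos (tw (ZMod 3) (ζ, 0) ψ) = pos ψ := by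
  have h01 : ∀ z : ZMod 2, z = 0 ∨ z = 1 := by decide
  rcases h01 ζ with rfl | rfl
  · rw [show ((0 : ZMod 2), (0 : ZMod 3)) = 0 from rfl, tw_zero]
  · rw [tw_one, show ((0 : ZMod 2), (0 : ZMod 3)) = 0 from rfl, tw_zero, pos_add_one]

/-- **Translating an ATOM coordinate by `1` lowers its odd position by `1`.** [folklore] -/
theorem pos_tw_of_clsTy {ψ : Ty (ZMod 3)} (h : clsTy (ZMod 3) ψ = 1) : pos (tw (ZMod 3) (0, 1) ψ) = pos ψ - 1 := by
  have key : ∀ a b c : ZMod 2, clsTy (ZMod 3) (fun s : ZMod 3 => (![a, b, c] : Fin 3 → ZMod 2) s) = 1 →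
      pos (tw (ZMod 3) (0, 1) (fun s : ZMod 3 => (![a, b, c] : Fin 3 → ZMod 2) s)) =
        pos (fun s : ZMod 3 => (![a, b, c] : Fin 3 → ZMod 2) s) - 1 := by decide
  rw [ty_eq_vec ψ] at h ⊢; exact key _ _ _ h

/-- **Untwisting the coordinate index**: `rot s m = σA^s m`. [folklore] -/
def rot (s : ZMod 3) (m : Fin 4) : Fin 4 := (![m, σA m, σA (σA m)] : Fin 3 → Fin 4) s

/-- **Untwisting the halves**: `rotP s h = h ∘ ρA^s`. [folklore] -/
def rotP (s : ZMod 3) (h : Fin 4 → Bool) : Fin 4 → Bool := (![h, h ∘ ρA, (h ∘ ρA) ∘ ρA] : Fin 3 → Fin 4 → Bool) s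

/-- **The untwisted signature** of an atom at coordinate `m`, odd position `s`, halves `h`: the three class-weighted components of gen 44ʼs `sigAll 1`
read after untwisting by `aˢ`. [folklore] -/
def code (m : Fin 4) (s : ZMod 3) (h : Fin 4 → Bool) : Bool × Bool × Bool :=
  ((sigAll 1 (fun k => decide (k = rot s m)) (rotP s h)).2.2.1, (sigAll 1 (fun k => decide (k = rot s m)) (rotP s h)).2.2.2.1,
    (sigAll 1 (fun k => decide (k = rot s m)) (rotP s h)).2.2.2.2)

/-- Statements about a pattern are checked on literal patterns. [folklore] -/
theorem pat_ind {P : (Fin 4 → Bool) → Prop} (hP : ∀ a b c d : Bool, P ![a, b, c, d]) (h : Fin 4 → Bool) : P h := by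
  have eh : h = ![h 0, h 1, h 2, h 3] := by funext n; fin_cases n <;> rfl
  rw [eh]; exact hP _ _ _ _

/-- **The untwisted signature is blind to `i`.** [folklore] -/
theorem code_Z (m : Fin 4) (s : ZMod 3) (h : Fin 4 → Bool) : code (σY m) s (fun n => xor (h (σY n)) (bY 1 n)) = code m s h := by
  revert m s
  refine pat_ind (P := fun h => ∀ m s, code (σY m) s (fun n => xor (h (σY n)) (bY 1 n)) = code m s h) ?_ h
  decide

/-- **The untwisted signature is blind to `k`.** [folklore] -/
theorem code_T (m : Fin 4) (s : ZMod 3) (h : Fin 4 → Bool) : code (σT m) s (fun n => xor (h (σT n)) (bT n)) = code m s h := by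
  revert m s
  refine pat_ind (P := fun h => ∀ m s, code (σT m) s (fun n => xor (h (σT n)) (bT n)) = code m s h) ?_ h
  decide

/-- **The untwisted signature is blind to `c`.** [folklore] -/
theorem code_flip (m : Fin 4) (s : ZMod 3) (h : Fin 4 → Bool) (b : Bool) : code m s (fun n => xor (h n) b) = code m s h := by
  revert m s b
  refine pat_ind (P := fun h => ∀ m s b, code m s (fun n => xor (h n) b) = code m s h) ?_ h
  decide

/-- **The untwisted signature is blind to `a`.** [folklore] -/
theorem code_A (m : Fin 4) (s : ZMod 3) (h : Fin 4 → Bool) : code (σA m) (s - 1) (h ∘ ρA) = code m s h := by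
  revert m s
  refine pat_ind (P := fun h => ∀ m s, code (σA m) (s - 1) (h ∘ ρA) = code m s h) ?_ h
  decide

/-- **The class-weighted term of coordinate `n`**: the untwisted signature of the atom there, `0` if there is none. [folklore] -/
def term (Θ : Ty₄ (ZMod 3)) (n : Fin 4) : Bool × Bool × Bool :=
  if cl (ZMod 3) Θ n = true then code n (pos (coord (ZMod 3) n Θ)) (hv (ZMod 3) Θ) else (false, false, false)

/-- **The signature of a label**: the coordinatewise XOR of the class-weighted terms. [folklore] -/
def sig₃ (Θ : Ty₄ (ZMod 3)) : Bool × Bool × Bool :=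
  (xor4 fun n => (term Θ n).1, xor4 fun n => (term Θ n).2.1, xor4 fun n => (term Θ n).2.2)

/-- **The invariant vector** of a label: potential, parity of the halves, signature. [folklore] -/
def inv₃ (Θ : Ty₄ (ZMod 3)) : ℕ × Bool × (Bool × Bool × Bool) := (pot₄ (ZMod 3) Θ, xor4 (hv (ZMod 3) Θ), sig₃ Θ)

/-- `xor4` is blind to the coordinate swap of `i`. [folklore] -/
theorem xor4_σY (f : Fin 4 → Bool) : xor4 (fun n => f (σY n)) = xor4 f :=
  pat_ind (P := fun f => xor4 (fun n => f (σY n)) = xor4 f) (by decide) f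
/-- `xor4` is blind to the coordinate swap of `k`. [folklore] -/
theorem xor4_σT (f : Fin 4 → Bool) : xor4 (fun n => f (σT n)) = xor4 f :=
  pat_ind (P := fun f => xor4 (fun n => f (σT n)) = xor4 f) (by decide) f
/-- `xor4` is blind to the coordinate rotation of `a`. [folklore] -/
theorem xor4_ρA (f : Fin 4 → Bool) : xor4 (fun n => f (ρA n)) = xor4 f :=
  pat_ind (P := fun f => xor4 (fun n => f (ρA n)) = xor4 f) (by decide) f
/-- `xor4` is blind to the half map of `i` (swap and even mask). [folklore] -/
theorem xor4_hvZ (f : Fin 4 → Bool) : xor4 (fun n => xor (f (σY n)) (bY 1 n)) = xor4 f :=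
  pat_ind (P := fun f => xor4 (fun n => xor (f (σY n)) (bY 1 n)) = xor4 f) (by decide) f
/-- `xor4` is blind to the half map of `k` (swap and even mask). [folklore] -/
theorem xor4_hvT (f : Fin 4 → Bool) : xor4 (fun n => xor (f (σT n)) (bT n)) = xor4 f :=
  pat_ind (P := fun f => xor4 (fun n => xor (f (σT n)) (bT n)) = xor4 f) (by decide) f
/-- `xor4` is blind to an even mask and to a global flip. [folklore] -/
theorem xor4_xor_const (f : Fin 4 → Bool) (b : Bool) : xor4 (fun n => xor (f n) b) = xor4 f := by
  revert b; exact pat_ind (P := fun f => ∀ b, xor4 (fun n => xor (f n) b) = xor4 f) (by decide) f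

/-- The class vector of `a·Θ` is the rotated class vector. [folklore] -/
theorem cl_twA (Θ : Ty₄ (ZMod 3)) (n : Fin 4) : cl (ZMod 3) (twA (ZMod 3) 1 Θ) n = cl (ZMod 3) Θ (ρA n) := by
  simp only [cl, coord_twA, clsTy_tw]

/-- The half vector of `a·Θ` is the rotated half vector. [folklore] -/
theorem hv_twA (Θ : Ty₄ (ZMod 3)) : hv (ZMod 3) (twA (ZMod 3) 1 Θ) = fun n => hv (ZMod 3) Θ (ρA n) :=
  funext fun n => half_coord_twA (ZMod 3) 1 Θ n

/-- **The terms of `i·Θ` are the swapped terms of `Θ`.** [folklore] -/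
theorem term_twZ (Θ : Ty₄ (ZMod 3)) (n : Fin 4) : term (twZ (ZMod 3) 1 Θ) n = term Θ (σY n) := by
  unfold term
  rw [cl_twZ, hv_twZ (ZMod 3) 1 odd3, coord_twZ, pos_add_ite]
  by_cases hc : cl (ZMod 3) Θ (σY n) = true
  · rw [if_pos hc, if_pos hc, ← code_Z (σY n), σY_σY]
  · rw [if_neg hc, if_neg hc]

/-- **The terms of `k·Θ` are the swapped terms of `Θ`.** [folklore] -/
theorem term_twT (Θ : Ty₄ (ZMod 3)) (n : Fin 4) : term (twT (ZMod 3) Θ) n = term Θ (σT n) := by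
  unfold term
  rw [cl_twT, hv_twT (ZMod 3) odd3, coord_twT, pos_add_ite]
  by_cases hc : cl (ZMod 3) Θ (σT n) = true
  · rw [if_pos hc, if_pos hc, ← code_T (σT n), σT_σT]
  · rw [if_neg hc, if_neg hc]

/-- **The terms of `c^ζ·Θ` are the terms of `Θ`.** [folklore] -/
theorem term_twH₄ (ζ : ZMod 2) (Θ : Ty₄ (ZMod 3)) (n : Fin 4) : term (twH₄ (ZMod 3) (ζ, 0) Θ) n = term Θ n := by
  unfold term
  rw [cl_twH₄, hv_twH₄ (ZMod 3) odd3, coord_twH₄, pos_tw_zero]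
  by_cases hc : cl (ZMod 3) Θ n = true
  · rw [if_pos hc, if_pos hc, code_flip]
  · rw [if_neg hc, if_neg hc]

/-- **The terms of `a·Θ` are the rotated terms of `Θ`.** [folklore] -/
theorem term_twA (Θ : Ty₄ (ZMod 3)) (n : Fin 4) : term (twA (ZMod 3) 1 Θ) n = term Θ (ρA n) := by
  unfold term
  rw [cl_twA, hv_twA, coord_twA]
  by_cases hc : cl (ZMod 3) Θ (ρA n) = true
  · rw [if_pos hc, if_pos hc]
    have hcls : clsTy (ZMod 3) (coord (ZMod 3) (ρA n) Θ) = 1 := by simpa [cl] using hc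
    rw [pos_tw_of_clsTy hcls, ← code_A (ρA n), σA_ρA]
    rfl
  · rw [if_neg hc, if_neg hc]

/-- The signature is blind to `i`. [folklore] -/
theorem sig₃_twZ (Θ : Ty₄ (ZMod 3)) : sig₃ (twZ (ZMod 3) 1 Θ) = sig₃ Θ := by
  unfold sig₃
  simp only [term_twZ]
  rw [xor4_σY (fun n => (term Θ n).1), xor4_σY (fun n => (term Θ n).2.1), xor4_σY (fun n => (term Θ n).2.2)]

/-- The signature is blind to `k`. [folklore] -/
theorem sig₃_twT (Θ : Ty₄ (ZMod 3)) : sig₃ (twT (ZMod 3) Θ) = sig₃ Θ := by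
  unfold sig₃
  simp only [term_twT]
  rw [xor4_σT (fun n => (term Θ n).1), xor4_σT (fun n => (term Θ n).2.1), xor4_σT (fun n => (term Θ n).2.2)]

/-- The signature is blind to `c`. [folklore] -/
theorem sig₃_twH₄ (ζ : ZMod 2) (Θ : Ty₄ (ZMod 3)) : sig₃ (twH₄ (ZMod 3) (ζ, 0) Θ) = sig₃ Θ := by
  unfold sig₃
  simp only [term_twH₄]

/-- The signature is blind to `a`. [folklore] -/
theorem sig₃_twA (Θ : Ty₄ (ZMod 3)) : sig₃ (twA (ZMod 3) 1 Θ) = sig₃ Θ := by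
  unfold sig₃
  simp only [term_twA]
  rw [xor4_ρA (fun n => (term Θ n).1), xor4_ρA (fun n => (term Θ n).2.1), xor4_ρA (fun n => (term Θ n).2.2)]

/-- **The invariant vector is constant along chains of motions.** [folklore] -/
theorem inv₃_eq_of_reach {Θ Θ' : Ty₄ (ZMod 3)} (h : Relation.ReflTransGen Step Θ Θ') : inv₃ Θ = inv₃ Θ' := by
  have hA : Odd (Fintype.card (ZMod 3)) := odd3
  induction h with
  | refl => rfl
  | tail _ hs ih =>
    rw [ih]
    rcases hs with ⟨ζ, rfl⟩ | rfl | rfl | rfl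
    · unfold inv₃; rw [pot₄_twH₄, sig₃_twH₄, hv_twH₄ (ZMod 3) hA, xor4_xor_const]
    · unfold inv₃; rw [pot₄_twZ, sig₃_twZ, hv_twZ (ZMod 3) 1 hA, xor4_hvZ]
    · unfold inv₃; rw [pot₄_twT, sig₃_twT, hv_twT (ZMod 3) hA, xor4_hvT]
    · unfold inv₃; rw [pot₄_twA, sig₃_twA, hv_twA, xor4_ρA]

/-- **Labels in the same block have the same invariant vector.** [folklore] -/
theorem inv₃_eq_of_blk_eq {Θ Θ' : Ty₄ (ZMod 3)} (h : blk Θ = blk Θ') : inv₃ Θ = inv₃ Θ' :=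
  inv₃_eq_of_reach ((blk_eq_blk_iff Θ Θ').mp h)

/-! ## §3 Ten residual blocks -/

/-- The invariant vector of gen 44ʼs atom label `aLab b` (atom `δ 0` at coordinate `0`, halves `b` elsewhere). [folklore] -/
theorem inv₃_aLab (b : Fin 4 → Bool) :
    inv₃ (aLab (ZMod 3) b) = (1, xor4 (fun n => if n = 0 then true else b n), code 0 0 (fun n => if n = 0 then true else b n)) := by
  have h2 : 2 ≤ Fintype.card (ZMod 3) := by simp
  have hpos : pos (coord (ZMod 3) 0 (aLab (ZMod 3) b)) = 0 := by
    rw [coord_aLab, if_pos rfl]; decide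
  have ht : ∀ n, term (aLab (ZMod 3) b) n =
      if n = 0 then code 0 0 (fun n => if n = 0 then true else b n) else (false, false, false) := by
    intro n
    unfold term
    rw [cl_aLab (ZMod 3) h2, hv_aLab (ZMod 3) h2]
    by_cases hn : n = 0
    · subst hn; rw [if_pos rfl, hpos]; simp only [decide_true, if_true]
    · simp only [hn, decide_false, Bool.false_eq_true, if_false]
  unfold inv₃ sig₃
  rw [pot₄_aLab (ZMod 3) h2, hv_aLab (ZMod 3) h2]
  simp only [ht, xor4, Fin.isValue, if_true, one_ne_zero, if_false, Fin.reduceEq, Bool.xor_false]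

/-- The invariant vector of gen 44ʼs constant label `kLab b`. [folklore] -/
theorem inv₃_kLab (b : Fin 4 → Bool) : inv₃ (kLab (ZMod 3) b) = (0, xor4 b, (false, false, false)) := by
  have h1 : 1 ≤ Fintype.card (ZMod 3) := by simp
  unfold inv₃ sig₃ term
  rw [pot₄_kLab, cl_kLab, hv_kLab (ZMod 3) h1]
  rfl

/-- **The eight atom labels have distinct invariants.** [folklore] -/
theorem atom_inj {x y z x' y' z' : Bool}
    (h : (xor4 (fun n => if n = 0 then true else (![false, x, y, z] : Fin 4 → Bool) n),
        code 0 0 (fun n => if n = 0 then true else (![false, x, y, z] : Fin 4 → Bool) n)) =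
      (xor4 (fun n => if n = 0 then true else (![false, x', y', z'] : Fin 4 → Bool) n),
        code 0 0 (fun n => if n = 0 then true else (![false, x', y', z'] : Fin 4 → Bool) n))) :
    (x, y, z) = (x', y', z') := by
  revert x y z x' y' z'; decide

/-- **AT LEAST TEN RESIDUAL BLOCKS**: eight atom blocks and two constant blocks. [folklore] -/
theorem ten_le_card_residual : 10 ≤ (univ.filter fun B : Block => potB B < 2).card := by
  let f : (Bool × Bool × Bool) ⊕ Bool → {B : Block // potB B < 2} := fun i =>
    match i with
    | Sum.inl ⟨x, y, z⟩ => ⟨blk (aLab (ZMod 3) ![false, x, y, z]), by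
        rw [potB_blk, pot₄_aLab (ZMod 3) (by simp)]; exact Nat.one_lt_two⟩
    | Sum.inr p => ⟨blk (kLab (ZMod 3) (kpat p false)), by rw [potB_blk, pot₄_kLab]; exact Nat.zero_lt_two⟩
  have hf : Function.Injective f := by
    rintro (⟨x, y, z⟩ | p) (⟨x', y', z'⟩ | p') hii' <;> have hb := inv₃_eq_of_blk_eq (congrArg Subtype.val hii')
    · rw [inv₃_aLab, inv₃_aLab, Prod.mk.injEq] at hb
      rw [atom_inj hb.2]
    · rw [inv₃_aLab, inv₃_kLab, Prod.mk.injEq] at hb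
      exact absurd hb.1 one_ne_zero
    · rw [inv₃_kLab, inv₃_aLab, Prod.mk.injEq] at hb
      exact absurd hb.1.symm one_ne_zero
    · rw [inv₃_kLab, inv₃_kLab, Prod.mk.injEq] at hb
      have hp : ∀ q q' : Bool, xor4 (kpat q false) = xor4 (kpat q' false) → q = q' := by decide
      rw [hp p p' (Prod.mk.inj hb.2).1]
  have hcard := Fintype.card_le_of_injective f hf
  rw [Fintype.card_subtype] at hcard
  simpa using hcard

end

end Summit.HodgeConjecture.CorCM.Census.BinaryTetrahedral
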